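import Summits.QuantumFields.YangMills.Theorems.BalabanLadderIRPinnedExitCofinal
import Literature.MathematicalPhysics.QuantumFieldTheory.YangMillsOSNonempty
import HarnessLib

/-!
# Row 49 «overlap-ruler» — TYPING NOTE on the located first lemma F1 (kernel-checked): `ScreenedAtStrongCoupling` is FALSE AS TYPED

Pool prover `ym-ir-line-pool-p3` g16 (2026-08-28), reading crit-3 g4's `VERDICT-overlap-ruler-idea21-crit3-g4.md` («F1 `ScreenedAtStrongCoupling`
(typed Prop, strong-coupling tube calibration, size L, width 0, NOT keyed) … What would raise the grade: F1 proved»).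

FINDING.  F1 (`OverlapRuler.ScreenedAtStrongCoupling`, `Cruxes/IRcof/Lines/overlap_ruler.lean` §5b, tree sha16 c2f40497261201b9) quantifies over EVERY
compact group `G` and every `r : LatticeRep G` — unlike S1 `PinnedScreenedCofinal` / S2 `ScreenedToPure`, it does NOT carry
`IsCompactSimpleLieGroup G`.  For an ABELIAN `G` the Haar twirl `g⁻¹ P_x g = P_x` is the identity, so the colour-singlet part of the eared-staple
trace IS the whole trace and the CHARGED eared-staple observable vanishes identically (`earedStapleObs_eq_zero_of_comm`; the card's own remark
«vanishes identically for abelian G»); hence `N_L ≡ 0` (`overlapNum_eq_zero_of_comm`), the positivity guard `0 < N_L(2u,u)` of `ScreenedAt`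
fails at EVERY `(β, L, q)` (`not_screenedAt_of_comm`), and F1 is refuted by `G = U(1) = Circle`, `r = LatticeRep.circle` (`N = 1`), `β = 1/216`,
`q = 0` (`not_screenedAtStrongCoupling`).  The same witness works for every compact abelian `G` (and the trivial group).

CLASS: misstated (missing side condition), NOT substantive.  Repaired reading F1′ (`ScreenedAtStrongCouplingSimple`, recorded only): insert
`IsCompactSimpleLieGroup G →` (as S1/S2 do); the abelian witness misses F1′ (`not_isCompactSimpleLieGroup_circle`).  Nothing else on row 49 is
affected: S1/S2 are typed on simple `G`; `pxcof_of_overlap`, the rung and `IRcof_of_stubs` do not mention F1.  Width toward PXcof / IRcof: 0.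

TECHNICAL.  `Lines/overlap_ruler.lean` is not a farm build target and cannot be imported, so §1 below is a VERBATIM copy of its §1 «Ruler»
(defs `shiftIter` … `ScreenedAt`) and of the §5b def `ScreenedAtStrongCoupling`, in the sub-namespace `…OverlapRuler.AbelianNegative`; the
theorems of §2–§3 are about these verbatim copies.

HONEST LABEL: a typing correction on an unregistered workfile `Prop`; proves nothing toward `IRcof` (stmt-QuantumFields-26930), `IR`
(stmt-QuantumFields-19354), PXcof, S1, S2 or the Yang–Mills mass gap (Clay), which is NOT proved anywhere in this tree; R4 closes only the
conditional finite-𝕋⁴ rung `BalabanLadder.UV`.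
-/

noncomputable section

open MeasureTheory
open Literature.MathematicalPhysics.QuantumFieldTheory Literature.MathematicalPhysics.QuantumLattice

namespace Summit.QuantumFields.YangMills.Cruxes.IRcof.OverlapRuler.AbelianNegative

/-! ## §1 VERBATIM copy of `Lines/overlap_ruler.lean` §1 «Ruler» and §5b `ScreenedAtStrongCoupling` (sha16 c2f40497261201b9) -/

section Ruler

variable {G : Type} [Group G]

/-- `k`-fold shift `x + k e_μ` on the `Fin`-indexed torus (periodic). [folklore] -/
def shiftIter {n₀ n₁ n₂ n₃ : ℕ} (x : FinTorusSite n₀ n₁ n₂ n₃) (μ : Fin 4) : ℕ → FinTorusSite n₀ n₁ n₂ n₃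
  | 0 => x
  | k + 1 => (shiftIter x μ k).shift μ

/-- Straight Wilson line of `k` links from `x` in direction `μ`: `U(x,μ) U(x+e_μ,μ) ⋯ U(x+(k−1)e_μ,μ)`. [folklore] -/
def lineHol {n₀ n₁ n₂ n₃ : ℕ} (U : FinTorusSite n₀ n₁ n₂ n₃ × Fin 4 → G) (x : FinTorusSite n₀ n₁ n₂ n₃) (μ : Fin 4) : ℕ → G
  | 0 => 1
  | k + 1 => lineHol U x μ k * U (shiftIter x μ k, μ)

/-- The STAPLE `x → x + T e₁ → x + T e₁ + R e₀ → x + R e₀` in the plane `(0,1)` (parallel transporter from `x` to `y = x + R e₀`).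
[cite: FredenhagenMarcu1983] -/
def stapleHol {n₀ n₁ n₂ n₃ : ℕ} (U : FinTorusSite n₀ n₁ n₂ n₃ × Fin 4 → G) (x : FinTorusSite n₀ n₁ n₂ n₃) (R T : ℕ) : G :=
  lineHol U x 1 T * lineHol U (shiftIter x 1 T) 0 R * (lineHol U (shiftIter x 0 R) 1 T)⁻¹

/-- The boundary of the rectangle `R × S` in the plane `(0,1)` based at `x` (a Wegner–Wilson loop holonomy). [cite: Wilson1974] -/
def rectHol {n₀ n₁ n₂ n₃ : ℕ} (U : FinTorusSite n₀ n₁ n₂ n₃ × Fin 4 → G) (x : FinTorusSite n₀ n₁ n₂ n₃) (R S : ℕ) : G :=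
  lineHol U x 0 R * lineHol U (shiftIter x 0 R) 1 S * (lineHol U (shiftIter x 1 S) 0 R)⁻¹ * (lineHol U x 1 S)⁻¹

variable {N : ℕ} (ρ : G →* Matrix (Fin N) (Fin N) ℂ)

/-- **The eared-staple trace** `Re tr ρ(P_y⁻¹ · C⁻¹ · P_x · C)`: ears `P_x = U_{x,23}` and the MIRROR ear `P_y⁻¹`, `y = x + R e₀`, joined by
the staple `C` of extent `R × T` in the plane `(0,1)` traversed there AND back — one gauge-invariant closed curve in the representation `ρ`
(the gluon Fredenhagen–Marcu numerator before removing the colour-singlet flux; the mirror orientation of the second ear is the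
reflection-positive arrangement for the site reflection in direction `0` through the midpoint of the `R`-leg). [cite: FredenhagenMarcu1983] -/
def earedStapleTr {n₀ n₁ n₂ n₃ : ℕ} (R T : ℕ) (U : FinTorusSite n₀ n₁ n₂ n₃ × Fin 4 → G) (x : FinTorusSite n₀ n₁ n₂ n₃) : ℝ :=
  (ρ ((finTorusPlaquette U (shiftIter x 0 R) 2 3)⁻¹ * (stapleHol U x R T)⁻¹ * finTorusPlaquette U x 2 3 * stapleHol U x R T)).trace.re

variable [TopologicalSpace G] [IsTopologicalGroup G] [CompactSpace G] [MeasurableSpace G] [BorelSpace G]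

/-- **The colour-singlet part of the eared-staple trace, by Haar twirl:** `∫_G Re tr ρ(P_y⁻¹ · C⁻¹ · g⁻¹ · P_x · g · C) dg` — inserting an
independent Haar rotation in the middle of the doubled staple projects `ρ ⊗ ρ̄` onto ALL its singlet channels (`∫ ρ(g)⁻¹ X ρ(g) dg` is the
conditional expectation onto the commutant `ρ(G)'`, of dimension `m_ρ`); exact for every faithful `ρ`, reducible or not (a `1∕N`-Fierz
subtraction would leave disconnected singlet pieces of size `O(g⁴)` for reducible `ρ` and spoil the femto reading). [folklore] -/
def earedStapleSinglet {n₀ n₁ n₂ n₃ : ℕ} (R T : ℕ) (U : FinTorusSite n₀ n₁ n₂ n₃ × Fin 4 → G) (x : FinTorusSite n₀ n₁ n₂ n₃) : ℝ :=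
  ∫ g, (ρ ((finTorusPlaquette U (shiftIter x 0 R) 2 3)⁻¹ * (stapleHol U x R T)⁻¹ * g⁻¹ * finTorusPlaquette U x 2 3 * g
      * stapleHol U x R T)).trace.re ∂(haarProbability G)

/-- **The CHARGED eared-staple observable** (gluon Fredenhagen–Marcu numerator): trace minus its Haar-twirled singlet part — only colour flux
genuinely transported along the staple survives; vanishes identically for abelian `G`. [cite: FredenhagenMarcu1983] -/
def earedStapleObs {n₀ n₁ n₂ n₃ : ℕ} (R T : ℕ) (U : FinTorusSite n₀ n₁ n₂ n₃ × Fin 4 → G) (x : FinTorusSite n₀ n₁ n₂ n₃) : ℝ :=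
  earedStapleTr ρ R T U x - earedStapleSinglet ρ R T U x

/-- **Calibration: the charged eared-staple observable VANISHES ON FLAT CONFIGURATIONS** (`U ≡ 1`): the Haar twirl removes exactly the
flux-free part (PROVED; the ruler reads transported colour flux only). -/
theorem earedStapleObs_flat {n₀ n₁ n₂ n₃ : ℕ} (R T : ℕ) (x : FinTorusSite n₀ n₁ n₂ n₃) :
    earedStapleObs ρ R T (fun _ => (1 : G)) x = 0 := by
  have hP : ∀ (y : FinTorusSite n₀ n₁ n₂ n₃) (μ ν : Fin 4), finTorusPlaquette (fun _ => (1 : G)) y μ ν = 1 := by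
    intro y μ ν; simp [finTorusPlaquette]
  have hL : ∀ (y : FinTorusSite n₀ n₁ n₂ n₃) (μ : Fin 4) (k : ℕ), lineHol (fun _ => (1 : G)) y μ k = 1 := by
    intro y μ k; induction k <;> simp [lineHol, *]
  have hC : ∀ (y : FinTorusSite n₀ n₁ n₂ n₃) (R T : ℕ), stapleHol (fun _ => (1 : G)) y R T = 1 := by
    intro y R T; simp [stapleHol, hL]
  haveI : IsProbabilityMeasure (haarProbability G) := inferInstance
  simp [earedStapleObs, earedStapleTr, earedStapleSinglet, hP, hC, Matrix.trace_one]

/-- The singlet content `m_ρ = ∫ |tr ρ(g)|² dHaar(g)` of `ρ ⊗ ρ̄` (Schur orthogonality: `dim ρ(G)'`; `1` for irreducible `ρ`). [folklore] -/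
def haarTraceSq : ℝ := ∫ g, ‖(ρ g).trace‖ ^ 2 ∂(haarProbability G)

/-- **The charged rectangle observable** `|tr ρ(U_∂(R × S))|² − m_ρ` (the `ρ ⊗ ρ̄` Wegner–Wilson loop with its singlet part removed —
the «adjoint loop» of Bietenholz–Wiese (14.65) for a general faithful `ρ`). [cite: FredenhagenMarcu1983] -/
def chargedRectObs {n₀ n₁ n₂ n₃ : ℕ} (R S : ℕ) (U : FinTorusSite n₀ n₁ n₂ n₃ × Fin 4 → G) (x : FinTorusSite n₀ n₁ n₂ n₃) : ℝ :=
  ‖(ρ (rectHol U x R S)).trace‖ ^ 2 - haarTraceSq ρ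

/-- Wilson's Boltzmann weight on the `Fin`-indexed torus (VERBATIM the integrand of `wilsonFinTorusPartition`). [cite: Wilson1974] -/
def finTorusWilsonWeight (β : ℝ) {n₀ n₁ n₂ n₃ : ℕ} (U : FinTorusSite n₀ n₁ n₂ n₃ × Fin 4 → G) : ℝ :=
  Real.exp (-β * ∑ x : FinTorusSite n₀ n₁ n₂ n₃, ∑ q : {q : Fin 4 × Fin 4 // q.1 < q.2},
      ((N : ℝ) - (ρ (finTorusPlaquette U x q.1.1 q.1.2)).trace.re))

/-- The Wilson MEAN of the site-average of a based observable `O U x` on the torus `n₀ × n₁ × n₂ × n₃` (site-averaging avoids choosing a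
base point; by translation invariance it is the mean of any single `O · x`).  `Z > 0` is the tree's `wilsonFinTorusPartition_pos`. [folklore] -/
def finTorusSiteMean (β : ℝ) (n₀ n₁ n₂ n₃ : ℕ)
    (O : (FinTorusSite n₀ n₁ n₂ n₃ × Fin 4 → G) → FinTorusSite n₀ n₁ n₂ n₃ → ℝ) : ℝ :=
  (∫ U, ((∑ x : FinTorusSite n₀ n₁ n₂ n₃, O U x) / (Fintype.card (FinTorusSite n₀ n₁ n₂ n₃) : ℝ))
        * finTorusWilsonWeight ρ β U
      ∂(Measure.pi fun _ : FinTorusSite n₀ n₁ n₂ n₃ × Fin 4 => haarProbability G))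
    / wilsonFinTorusPartition ρ β n₀ n₁ n₂ n₃

/-- `N_L(R,T)` — the charged eared-staple MEAN (Fredenhagen–Marcu numerator) on the slot's box `L³ × ⌊L∕4⌋`. -/
def overlapNum (β : ℝ) (L R T : ℕ) : ℝ :=
  finTorusSiteMean ρ β L L L (L / 4) (earedStapleObs ρ R T)

/-- `D_L(R,S)` — the charged-rectangle MEAN (Fredenhagen–Marcu denominator before the square root) on the slot's box `L³ × ⌊L∕4⌋`. -/
def overlapDen (β : ℝ) (L R S : ℕ) : ℝ :=
  finTorusSiteMean ρ β L L L (L / 4) (chargedRectObs ρ R S)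

/-- **`ScreenedAt ρ β L q` — THE RULER READING (the OVERLAP SCALING QUOTIENT of the box is at least `q`).**  With `u = ⌊L∕16⌋`, big staple
`(R,T) = (4u,2u)` over the charged square `4u × 4u`, small staple `(2u,u)` over `2u × 2u`:
`Q_L := [N_L(4u,2u) ∕ √D_L(4u,4u)] ∕ [N_L(2u,u) ∕ √D_L(2u,2u)] ≥ q`, typed division-free with its positivity guards.  A DOUBLE ratio: the
Fredenhagen–Marcu square root cancels the perimeter ∕ corner self-energies of the doubled staple, the big∕small quotient cancels the local
(coupling-dependent but geometry-independent) renormalisation of the plaquette ears and of the ear–staple junctions — so `Q_L` is a unit-free,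
twist-free, CENTRE-BLIND reading with (heuristically) a continuum limit at fixed physical box, separating `q_fem(G) < 1` (Coulombic at its
own scale; Gaussian part `2⁻⁴`) from `1` (gluon-screened at its own scale: FM scale-free). [cite: FredenhagenMarcu1983] -/
def ScreenedAt (β : ℝ) (L : ℕ) (q : ℝ) : Prop :=
  0 < overlapNum ρ β L (2 * (L / 16)) (L / 16) ∧ 0 < overlapDen ρ β L (4 * (L / 16)) (4 * (L / 16)) ∧
    0 < overlapDen ρ β L (2 * (L / 16)) (2 * (L / 16)) ∧
    q * (overlapNum ρ β L (2 * (L / 16)) (L / 16) * Real.sqrt (overlapDen ρ β L (4 * (L / 16)) (4 * (L / 16)))) ≤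
      overlapNum ρ β L (4 * (L / 16)) (2 * (L / 16)) * Real.sqrt (overlapDen ρ β L (2 * (L / 16)) (2 * (L / 16)))

end Ruler

/-- **F1 `ScreenedAtStrongCoupling`** — the Fredenhagen–Marcu ∕ Bietenholz–Wiese strong-coupling TUBE picture as a theorem target, on the
slot's boxes: for every compact `G`, every faithful `r`, every `0 < β` with `216·N·β ≤ 1` and every level `q < 1` there is a fineness `L₁`
with `ScreenedAt r.ρ β L q` for all `L ≥ L₁` (numerator and charged square are dominated by the minimal plaquette tubes along the doubled
staple resp. the square's perimeter, by convergent polymer ∕ character expansion; the tube weights per unit length coincide, so each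
Fredenhagen–Marcu ratio is `R,T`-independent up to exponentially small corrections and the quotient tends to `1`; FM83 prove the `ℤ₂`-Higgs
analogue this way).  The ruler's CALIBRATION and S1's strong-coupling corner; no width toward PXcof (sieve S3: inoperative as `β → ∞`).
[cite: FredenhagenMarcu1983] -/
def ScreenedAtStrongCoupling : Prop :=
  ∀ (G : Type) [Group G] [TopologicalSpace G] [IsTopologicalGroup G] [CompactSpace G] [MeasurableSpace G] [BorelSpace G]
    (r : LatticeRep G) (β : ℝ), 0 < β → 216 * (r.N : ℝ) * β ≤ 1 →
    ∀ q : ℝ, q < 1 → ∃ L₁ : ℕ, ∀ L : ℕ, L₁ ≤ L → ScreenedAt r.ρ β L q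

/-! ## §2 Abelian `G`: the charged eared-staple observable vanishes identically; the ruler never reads -/

section Abelian

variable {G : Type} [CommGroup G] {N : ℕ} (ρ : G →* Matrix (Fin N) (Fin N) ℂ)
  [TopologicalSpace G] [IsTopologicalGroup G] [CompactSpace G] [MeasurableSpace G] [BorelSpace G]

/-- For ABELIAN `G` the Haar twirl is the identity: the colour-singlet part of the eared-staple trace equals the whole trace. -/
theorem earedStapleSinglet_eq_tr_of_comm {n₀ n₁ n₂ n₃ : ℕ} (R T : ℕ) (U : FinTorusSite n₀ n₁ n₂ n₃ × Fin 4 → G)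
    (x : FinTorusSite n₀ n₁ n₂ n₃) : earedStapleSinglet ρ R T U x = earedStapleTr ρ R T U x := by
  unfold earedStapleSinglet earedStapleTr
  have key : ∀ g : G,
      (finTorusPlaquette U (shiftIter x 0 R) 2 3)⁻¹ * (stapleHol U x R T)⁻¹ * g⁻¹ * finTorusPlaquette U x 2 3 * g
          * stapleHol U x R T =
        (finTorusPlaquette U (shiftIter x 0 R) 2 3)⁻¹ * (stapleHol U x R T)⁻¹ * finTorusPlaquette U x 2 3 * stapleHol U x R T := by
    intro g
    rw [mul_assoc (_ * _) g⁻¹ (finTorusPlaquette U x 2 3), mul_comm g⁻¹ (finTorusPlaquette U x 2 3), ← mul_assoc,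
      mul_assoc (_ * _ * finTorusPlaquette U x 2 3) g⁻¹ g, inv_mul_cancel, mul_one]
  simp_rw [key]
  haveI : IsProbabilityMeasure (haarProbability G) := inferInstance
  simp [integral_const]

/-- **The charged eared-staple observable vanishes identically for abelian `G`** (at every configuration, not only flat ones). -/
theorem earedStapleObs_eq_zero_of_comm {n₀ n₁ n₂ n₃ : ℕ} (R T : ℕ) (U : FinTorusSite n₀ n₁ n₂ n₃ × Fin 4 → G)
    (x : FinTorusSite n₀ n₁ n₂ n₃) : earedStapleObs ρ R T U x = 0 := by
  rw [earedStapleObs, earedStapleSinglet_eq_tr_of_comm, sub_self]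

/-- Hence the Fredenhagen–Marcu numerator `N_L(R,T)` is `0` for abelian `G`, at every coupling and box. -/
theorem overlapNum_eq_zero_of_comm (β : ℝ) (L R T : ℕ) : overlapNum ρ β L R T = 0 := by
  simp [overlapNum, finTorusSiteMean, earedStapleObs_eq_zero_of_comm]

/-- Hence the ruler never reads for abelian `G`: the positivity guard `0 < N_L(2u,u)` of `ScreenedAt` fails at every `(β, L, q)`. -/
theorem not_screenedAt_of_comm (β : ℝ) (L : ℕ) (q : ℝ) : ¬ ScreenedAt ρ β L q := by
  rintro ⟨h, -, -, -⟩
  rw [overlapNum_eq_zero_of_comm] at h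
  exact lt_irrefl 0 h

end Abelian

/-! ## §3 F1 is false as typed; the repaired reading F1′ and why the witness misses it -/

/-- **F1 `ScreenedAtStrongCoupling` is FALSE AS TYPED** — witness `G = U(1) = Circle`, `r = LatticeRep.circle` (`N = 1`), `β = 1/216`
(so `0 < β` and `216·N·β ≤ 1`), `q = 0 < 1`: F1 would give an `L₁` with `ScreenedAt r.ρ β L₁ 0`, contradicting `not_screenedAt_of_comm`. -/
theorem not_screenedAtStrongCoupling : ¬ ScreenedAtStrongCoupling := by
  intro h
  letI : MeasurableSpace Circle := borel Circle
  haveI : BorelSpace Circle := ⟨rfl⟩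
  obtain ⟨L₁, hL₁⟩ := h Circle LatticeRep.circle (1 / 216) (by norm_num) (by norm_num [LatticeRep.circle_N]) 0 (by norm_num)
  exact not_screenedAt_of_comm LatticeRep.circle.ρ (1 / 216) L₁ 0 (hL₁ L₁ le_rfl)

/-- The repaired statement F1′ (F1 with the simple-group side condition of S1/S2) — RECORDED ONLY, as the shape a prover of row 49's located
lemma should target; not asserted, not a token of any registered line. -/
def ScreenedAtStrongCouplingSimple : Prop :=
  ∀ (G : Type) [Group G] [TopologicalSpace G] [IsTopologicalGroup G] [CompactSpace G] [MeasurableSpace G] [BorelSpace G],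
    IsCompactSimpleLieGroup G →
    ∀ (r : LatticeRep G) (β : ℝ), 0 < β → 216 * (r.N : ℝ) * β ≤ 1 →
    ∀ q : ℝ, q < 1 → ∃ L₁ : ℕ, ∀ L : ℕ, L₁ ≤ L → ScreenedAt r.ρ β L q

/-- F1 as typed implies F1′ trivially (bookkeeping: the repair only ADDS a hypothesis). -/
theorem screenedAtStrongCouplingSimple_of (h : ScreenedAtStrongCoupling) : ScreenedAtStrongCouplingSimple :=
  fun G _ _ _ _ _ _ _ r β hβ hN q hq => h G r β hβ hN q hq

/-- The abelian witness misses F1′: `Circle` is not a compact simple Lie group (`IsSimpleCompactGroup` demands a non-commuting pair). -/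
theorem not_isCompactSimpleLieGroup_circle : ¬ IsCompactSimpleLieGroup Circle := by
  rintro ⟨⟨-, ⟨a, b, hab⟩, -⟩, -⟩
  exact hab (mul_comm a b)

end Summit.QuantumFields.YangMills.Cruxes.IRcof.OverlapRuler.AbelianNegative

end
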